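import Summits.Ventures.LatticeQCDFlow.TrivializingMaps.AcceptanceFootprint
import Summits.Ventures.LatticeQCDFlow.Scoring.KernelTransitionOperator
import HarnessLib

/-!
# The sharp acceptance–footprint constant: `|Cov_π(A, B)| ≤ 4 (1 - acc) a b`

HONEST FRAMING: exact (Metropolis-corrected) sampling algorithms for lattice gauge theory; figures of merit are
autocorrelation/cost numbers at stated couplings and volumes; no continuum-physics claim.

Venture `LatticeQCDFlow` (cell pub-lqcd), topic `TrivializingMaps`; FANOUT row 28 (theory-1), THEOREM Q♯ of
THEORY-1 §33 ((O1)).  NEW WORK of the cell (elementary); nothing cited as a fact (named only: Albergo–Kanwar–Shanahan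
2019 §II.C, Nicoli et al. 2020, Lüscher 2010 §3.3).  Companion `AcceptanceFootprintFloor`: `4` is optimal.

## What is proved (0 `sorry`)

* §1 `Sharp.*` — `(s - s₀)(t - t₀)` over `|s|, |s₀| ≤ a`, `|t|, |t₀| ≤ b` has range width `2 (a b + max (a |t₀|, b |s₀|))`.
* §2 **`abs_cov_le_of_integralClose_sharp`**, **`abs_cov_le_two_mul_of_integralClose`** — probability laws
  `π`, `ν` with `|⟨h⟩_π - ⟨h⟩_ν| ≤ ε sup|h|` (`IntegralClose`), measurable `|A| ≤ a`, `|B| ≤ b` exactly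
  uncorrelated under `ν`: `|Cov_π(A, B)| ≤ ε (a b + max (a |⟨B⟩_ν|, b |⟨A⟩_π|)) ≤ 2 ε a b` (the tree's
  `abs_cov_le_of_integralClose`: `3 ε a b`), by the ONE test function `h = (A - ⟨A⟩_π)(B - ⟨B⟩_ν)`.
* §3 PROP R / THEOREM Q / FOOTPRINT LAW with the improved constants: `abs_cov_le_two_mul_of_integralClose_pushforward`
  (`2 ε a b`), **`abs_cov_le_four_mul_of_meanAccept`**, **`abs_cov_le_four_mul_of_meanAccept_of_range`**
  (`4 (1 - acc) a b`), `sep_le_two_mul_range_of_meanAccept_four`, the lattice gauge instances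
  `Gauge.abs_cov_boltzmann_le_four_mul_of_meanAccept`, `Gauge.sep_le_two_mul_range_of_meanAccept_four`
  (`π = 𝒵⁻¹ e^{-S} D[U]`, `S` continuous, any `β`, `L`, `n`), and `Sharp.linear_law_four` (two two-state links).

READING: a range-`r` flow proposal with equilibrium acceptance `acc` has `2 r ≥ sep` wherever the target has a
bounded witness pair `sep` apart with `|Cov| > 4 (1 - acc) a b` (was `6`).  NOT CLAIMED: quasi-local maps; ESS.
-/

namespace Summit.Ventures.LatticeQCDFlow.TrivializingMaps

open MeasureTheory Set
open scoped ENNReal NNReal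

/-! ## §1. The bilinear range lemma -/

namespace Sharp

/-- `|x + y| + |x - y| ≤ 2 max (|x|, |y|)` (in fact an equality). -/
theorem abs_add_add_abs_sub_le (x y : ℝ) : |x + y| + |x - y| ≤ 2 * max |x| |y| := by
  rcases le_total 0 (x + y) with h₁ | h₁ <;> rcases le_total 0 (x - y) with h₂ | h₂ <;>
    simp only [abs_of_nonneg, abs_of_nonpos, h₁, h₂] <;>
    [have := le_max_left |x| |y|; have := le_max_right |x| |y|; have := le_max_right |x| |y|;
      have := le_max_left |x| |y|] <;>
    linarith [le_abs_self x, neg_abs_le x, le_abs_self y, neg_abs_le y]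

/-- Upper corner bound: `(s - s₀)(t - t₀) ≤ s₀ t₀ + a b + |a t₀ + b s₀|`. -/
theorem mul_sub_mul_sub_le {s s₀ t t₀ a b : ℝ} (hs : |s| ≤ a) (hs₀ : |s₀| ≤ a) (ht : |t| ≤ b)
    (ht₀ : |t₀| ≤ b) : (s - s₀) * (t - t₀) ≤ s₀ * t₀ + a * b + |a * t₀ + b * s₀| := by
  obtain ⟨hs1, hs2⟩ := abs_le.1 hs
  obtain ⟨hs01, hs02⟩ := abs_le.1 hs₀
  obtain ⟨ht1, ht2⟩ := abs_le.1 ht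
  obtain ⟨ht01, ht02⟩ := abs_le.1 ht₀
  rcases le_or_gt t₀ t with h | h
  · nlinarith [mul_nonneg (sub_nonneg.2 hs2) (sub_nonneg.2 h),
      mul_nonneg (sub_nonneg.2 hs02) (sub_nonneg.2 ht2), neg_abs_le (a * t₀ + b * s₀)]
  · nlinarith [mul_nonneg (neg_nonneg.2 (sub_nonpos.2 h.le)) (by linarith : 0 ≤ s + a),
      mul_nonneg (by linarith : 0 ≤ a + s₀) (by linarith : 0 ≤ t + b), le_abs_self (a * t₀ + b * s₀)]

/-- Lower corner bound: `s₀ t₀ - a b - |a t₀ - b s₀| ≤ (s - s₀)(t - t₀)`. -/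
theorem le_mul_sub_mul_sub {s s₀ t t₀ a b : ℝ} (hs : |s| ≤ a) (hs₀ : |s₀| ≤ a) (ht : |t| ≤ b)
    (ht₀ : |t₀| ≤ b) : s₀ * t₀ - a * b - |a * t₀ - b * s₀| ≤ (s - s₀) * (t - t₀) := by
  obtain ⟨hs1, hs2⟩ := abs_le.1 hs
  obtain ⟨hs01, hs02⟩ := abs_le.1 hs₀
  obtain ⟨ht1, ht2⟩ := abs_le.1 ht
  obtain ⟨ht01, ht02⟩ := abs_le.1 ht₀
  rcases le_or_gt t₀ t with h | h
  · nlinarith [mul_nonneg (by linarith : 0 ≤ s + a) (sub_nonneg.2 h),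
      mul_nonneg (by linarith : 0 ≤ a + s₀) (sub_nonneg.2 ht2), neg_abs_le (a * t₀ - b * s₀)]
  · nlinarith [mul_nonneg (sub_nonneg.2 hs2) (neg_nonneg.2 (sub_nonpos.2 h.le)),
      mul_nonneg (sub_nonneg.2 hs02) (by linarith : 0 ≤ t + b), le_abs_self (a * t₀ - b * s₀)]

/-- **Width of the bilinear range.**  For `|s|, |s₀| ≤ a` and `|t|, |t₀| ≤ b`, the product
`(s - s₀)(t - t₀)` lies within `a b + max (a |t₀|, b |s₀|)` of the centre
`s₀ t₀ + (|a t₀ + b s₀| - |a t₀ - b s₀|)/2`. -/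
theorem abs_mul_sub_mul_sub_sub_le {s s₀ t t₀ a b : ℝ} (hs : |s| ≤ a) (hs₀ : |s₀| ≤ a) (ht : |t| ≤ b)
    (ht₀ : |t₀| ≤ b) :
    |(s - s₀) * (t - t₀) - (s₀ * t₀ + (|a * t₀ + b * s₀| - |a * t₀ - b * s₀|) / 2)|
      ≤ a * b + max (a * |t₀|) (b * |s₀|) := by
  have ha : 0 ≤ a := (abs_nonneg _).trans hs
  have hb : 0 ≤ b := (abs_nonneg _).trans ht
  have hup := mul_sub_mul_sub_le hs hs₀ ht ht₀
  have hlo := le_mul_sub_mul_sub hs hs₀ ht ht₀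
  have hmax : |a * t₀ + b * s₀| + |a * t₀ - b * s₀| ≤ 2 * max (a * |t₀|) (b * |s₀|) := by
    have h := abs_add_add_abs_sub_le (a * t₀) (b * s₀)
    rwa [abs_mul, abs_mul, abs_of_nonneg ha, abs_of_nonneg hb] at h
  rw [abs_le]
  constructor <;> linarith

/-- The width is at most `2 a b`. -/
theorem max_le_mul {s₀ t₀ a b : ℝ} (hs₀ : |s₀| ≤ a) (ht₀ : |t₀| ≤ b) (ha : 0 ≤ a) (hb : 0 ≤ b) :
    max (a * |t₀|) (b * |s₀|) ≤ a * b :=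
  max_le (mul_le_mul_of_nonneg_left ht₀ ha) (by rw [mul_comm]; exact mul_le_mul_of_nonneg_right hs₀ hb)

end Sharp

/-! ## §2. Dual closeness `⟹` clustering transfer with the sharp constant -/

section Dual

variable {Ω : Type*} [MeasurableSpace Ω]

/-- An `IntegralClose` constant is nonnegative. -/
theorem IntegralClose.nonneg {π ν : Measure Ω} {ε : ℝ} (h : IntegralClose π ν ε) : 0 ≤ ε := by
  have := h (fun _ => 0) 1 measurable_const zero_le_one (fun _ => by simp)
  simpa using this

/-- `|⟨f⟩_μ| ≤ c` for `|f| ≤ c` under a probability law. -/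
theorem covTest_abs_integral_le (μ : Measure Ω) [IsProbabilityMeasure μ] {f : Ω → ℝ} {c : ℝ}
    (hf : ∀ x, |f x| ≤ c) : |∫ x, f x ∂μ| ≤ c := by
  have h := norm_integral_le_of_norm_le_const (μ := μ) (f := f) (C := c)
    (Filter.Eventually.of_forall fun x => by simpa [Real.norm_eq_abs] using hf x)
  simpa [Real.norm_eq_abs] using h

/-- The mean of the test function `(A - s₀)(B - t₀) - c` under a probability law. -/
theorem integral_mul_sub_mul_sub_sub (μ : Measure Ω) [IsProbabilityMeasure μ] {A B : Ω → ℝ}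
    (hAm : Measurable A) (hBm : Measurable B) {a b : ℝ} (hA : ∀ x, |A x| ≤ a) (hB : ∀ x, |B x| ≤ b)
    (s₀ t₀ c : ℝ) :
    ∫ x, ((A x - s₀) * (B x - t₀) - c) ∂μ
      = ∫ x, A x * B x ∂μ - s₀ * ∫ x, B x ∂μ - t₀ * ∫ x, A x ∂μ + (s₀ * t₀ - c) := by
  obtain ⟨x₀⟩ : Nonempty Ω := nonempty_of_isProbabilityMeasure μ
  have ha : 0 ≤ a := (abs_nonneg _).trans (hA x₀)
  have hAB : Integrable (fun x => A x * B x) μ :=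
    Scoring.integrable_of_bounded μ (g := fun x => A x * B x) (hAm.mul hBm) (C := a * b) fun x => by
      simp only [abs_mul]; exact mul_le_mul (hA x) (hB x) (abs_nonneg _) ha
  have hIA : Integrable A μ := Scoring.integrable_of_bounded μ hAm hA
  have hIB : Integrable B μ := Scoring.integrable_of_bounded μ hBm hB
  have e : (fun x => (A x - s₀) * (B x - t₀) - c)
      = fun x => (A x * B x - s₀ * B x - t₀ * A x) + (s₀ * t₀ - c) := by
    funext x; ring
  have h2 : Integrable (fun x => A x * B x - s₀ * B x) μ := hAB.sub (hIB.const_mul s₀)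
  have h3 : Integrable (fun x => A x * B x - s₀ * B x - t₀ * A x) μ := h2.sub (hIA.const_mul t₀)
  rw [e, integral_add h3 (integrable_const _), integral_sub h2 (hIA.const_mul t₀),
    integral_sub hAB (hIB.const_mul s₀), integral_const_mul, integral_const_mul, integral_const, smul_eq_mul,
    probReal_univ, one_mul]

/-- **Dual closeness `⟹` clustering transfer, SHARP FORM**: `IntegralClose π ν ε`, `|A| ≤ a`, `|B| ≤ b`
measurable and exactly uncorrelated under `ν` `⟹` `|Cov_π(A, B)| ≤ ε (a b + max (a |⟨B⟩_ν|, b |⟨A⟩_π|))` (test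
function `h = (A - ⟨A⟩_π)(B - ⟨B⟩_ν)`: `⟨h⟩_ν = 0`, `⟨h⟩_π = Cov_π(A, B)`, re-centred sup-norm by §1). -/
theorem abs_cov_le_of_integralClose_sharp (π ν : Measure Ω) [IsProbabilityMeasure π]
    [IsProbabilityMeasure ν] {ε : ℝ} (hclose : IntegralClose π ν ε) {A B : Ω → ℝ}
    (hAm : Measurable A) (hBm : Measurable B) {a b : ℝ} (hA : ∀ x, |A x| ≤ a) (hB : ∀ x, |B x| ≤ b)
    (hfac : ∫ x, A x * B x ∂ν = (∫ x, A x ∂ν) * ∫ x, B x ∂ν) :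
    |∫ x, A x * B x ∂π - (∫ x, A x ∂π) * ∫ x, B x ∂π|
      ≤ ε * (a * b + max (a * |∫ x, B x ∂ν|) (b * |∫ x, A x ∂π|)) := by
  obtain ⟨x₀⟩ : Nonempty Ω := nonempty_of_isProbabilityMeasure π
  set s₀ := ∫ x, A x ∂π with hs₀def
  set t₀ := ∫ x, B x ∂ν with ht₀def
  have hs₀ : |s₀| ≤ a := covTest_abs_integral_le π hA
  have ht₀ : |t₀| ≤ b := covTest_abs_integral_le ν hB
  set c := s₀ * t₀ + (|a * t₀ + b * s₀| - |a * t₀ - b * s₀|) / 2 with hcdef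
  set w := a * b + max (a * |t₀|) (b * |s₀|) with hwdef
  have hhm : Measurable fun x => (A x - s₀) * (B x - t₀) - c :=
    ((hAm.sub measurable_const).mul (hBm.sub measurable_const)).sub measurable_const
  have hhb : ∀ x, |(A x - s₀) * (B x - t₀) - c| ≤ w :=
    fun x => Sharp.abs_mul_sub_mul_sub_sub_le (hA x) hs₀ (hB x) ht₀
  have hw : 0 ≤ w := (abs_nonneg _).trans (hhb x₀)
  have key := hclose _ w hhm hw hhb
  rw [integral_mul_sub_mul_sub_sub π hAm hBm hA hB, integral_mul_sub_mul_sub_sub ν hAm hBm hA hB, hfac,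
    ← hs₀def, ← ht₀def] at key
  have e : ∫ x, A x * B x ∂π - s₀ * ∫ x, B x ∂π - t₀ * s₀ + (s₀ * t₀ - c)
      - ((∫ x, A x ∂ν) * t₀ - s₀ * t₀ - t₀ * ∫ x, A x ∂ν + (s₀ * t₀ - c))
      = ∫ x, A x * B x ∂π - s₀ * ∫ x, B x ∂π := by ring
  rwa [e] at key

/-- **`|Cov_π(A, B)| ≤ 2 ε a b`** (the tree's `abs_cov_le_of_integralClose` has `3 ε a b`). -/
theorem abs_cov_le_two_mul_of_integralClose (π ν : Measure Ω) [IsProbabilityMeasure π]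
    [IsProbabilityMeasure ν] {ε : ℝ} (hclose : IntegralClose π ν ε) {A B : Ω → ℝ}
    (hAm : Measurable A) (hBm : Measurable B) {a b : ℝ} (hA : ∀ x, |A x| ≤ a) (hB : ∀ x, |B x| ≤ b)
    (hfac : ∫ x, A x * B x ∂ν = (∫ x, A x ∂ν) * ∫ x, B x ∂ν) :
    |∫ x, A x * B x ∂π - (∫ x, A x ∂π) * ∫ x, B x ∂π| ≤ 2 * ε * (a * b) := by
  obtain ⟨x₀⟩ : Nonempty Ω := nonempty_of_isProbabilityMeasure π
  have ha : 0 ≤ a := (abs_nonneg _).trans (hA x₀)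
  have hb : 0 ≤ b := (abs_nonneg _).trans (hB x₀)
  have h := abs_cov_le_of_integralClose_sharp π ν hclose hAm hBm hA hB hfac
  have hm := Sharp.max_le_mul (covTest_abs_integral_le π hA) (covTest_abs_integral_le ν hB) ha hb
  have hε := hclose.nonneg
  nlinarith [mul_le_mul_of_nonneg_left hm hε]

end Dual

/-! ## §3. PROP R, THEOREM Q and the footprint law with the sharp constants -/

section Densities

variable {X : Type*} [MeasurableSpace X] {μ : Measure X} {p q : X → ℝ}
variable [SFinite μ]

/-- **THEOREM Q♯ (abstract)**: `A`, `B` (`|A| ≤ a`, `|B| ≤ b` measurable) exactly uncorrelated under the model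
`q·μ`, equilibrium acceptance of the independence sampler for `p·μ` at least `acc` `⟹` `|Cov_π(A, B)| ≤ 4 (1 - acc) a b`. -/
theorem abs_cov_le_four_mul_of_meanAccept (hp0 : ∀ x, 0 ≤ p x) (hpm : Measurable p)
    (hpi : Integrable p μ) (hp1 : ∫ x, p x ∂μ = 1) (hq0 : ∀ x, 0 ≤ q x) (hqm : Measurable q)
    (hqi : Integrable q μ) (hq1 : ∫ x, q x ∂μ = 1) {acc : ℝ}
    (hacc : acc ≤ ∫ x, ∫ y, min (p x * q y) (p y * q x) ∂μ ∂μ) {A B : X → ℝ} (hAm : Measurable A)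
    (hBm : Measurable B) {a b : ℝ} (hA : ∀ x, |A x| ≤ a) (hB : ∀ x, |B x| ≤ b)
    (hfac : ∫ x, A x * B x ∂(μ.withDensity fun x => ENNReal.ofReal (q x))
      = (∫ x, A x ∂(μ.withDensity fun x => ENNReal.ofReal (q x)))
        * ∫ x, B x ∂(μ.withDensity fun x => ENNReal.ofReal (q x))) :
    |∫ x, A x * B x ∂(μ.withDensity fun x => ENNReal.ofReal (p x))
        - (∫ x, A x ∂(μ.withDensity fun x => ENNReal.ofReal (p x)))
          * ∫ x, B x ∂(μ.withDensity fun x => ENNReal.ofReal (p x))| ≤ 4 * (1 - acc) * (a * b) := by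
  haveI := isProbabilityMeasure_withDensity_ofReal hp0 hpi hp1
  haveI := isProbabilityMeasure_withDensity_ofReal hq0 hqi hq1
  have h := abs_cov_le_two_mul_of_integralClose _ _
    (integralClose_of_meanAccept hp0 hpm hpi hp1 hq0 hqm hqi hq1 hacc) hAm hBm hA hB hfac
  linarith

end Densities

section Range

variable {ι : Type*} [Fintype ι] {α : Type*} [MeasurableSpace α]
variable (μ₀ : Measure α) [IsProbabilityMeasure μ₀]

/-- **PROPOSITION R (ε-version) with constant `2`**: `π` `ε`-close to the push-forward of the i.i.d. law under
a range-`r` map `⟹` `|Cov_π(A, B)| ≤ 2 ε a b` for observables supported more than `2 r` apart. -/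
theorem abs_cov_le_two_mul_of_integralClose_pushforward (π : Measure (ι → α)) [IsProbabilityMeasure π]
    (d : ι → ι → ℕ) (hsymm : ∀ a b, d a b = d b a) (htri : ∀ a b c, d a c ≤ d a b + d b c)
    {Φ : (ι → α) → (ι → α)} (hΦm : Measurable Φ) {N : ι → Set ι}
    (hΦ : ∀ i, DependsOn (fun W => Φ W i) (N i)) {r : ℕ} (hN : ∀ i, ∀ j ∈ N i, d i j ≤ r)
    {ε : ℝ} (hclose : IntegralClose π ((Measure.pi fun _ : ι => μ₀).map Φ) ε)
    {A B : (ι → α) → ℝ} (hAm : Measurable A) (hBm : Measurable B) {a b : ℝ}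
    (hAa : ∀ x, |A x| ≤ a) (hBb : ∀ x, |B x| ≤ b) {S T : Set ι} (hA : DependsOn A S)
    (hB : DependsOn B T) (hsep : ∀ i ∈ S, ∀ j ∈ T, 2 * r < d i j) :
    |∫ U, A U * B U ∂π - (∫ U, A U ∂π) * ∫ U, B U ∂π| ≤ 2 * ε * (a * b) := by
  haveI : IsProbabilityMeasure ((Measure.pi fun _ : ι => μ₀).map Φ) :=
    Measure.isProbabilityMeasure_map hΦm.aemeasurable
  exact abs_cov_le_two_mul_of_integralClose π _ hclose hAm hBm hAa hBb
    (pushforward_integral_mul_eq_of_range μ₀ d hsymm htri hΦm hΦ hN hAm hBm hA hB hsep)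

/-- **THEOREM Q♯ (acceptance bounds the footprint, constant `4`).**  Same setting as the tree's
`abs_cov_le_of_meanAccept_of_range`; conclusion `|Cov_π(A, B)| ≤ 4 (1 - acc) a b`. -/
theorem abs_cov_le_four_mul_of_meanAccept_of_range {p q : (ι → α) → ℝ} (hp0 : ∀ x, 0 ≤ p x)
    (hpm : Measurable p) (hpi : Integrable p (Measure.pi fun _ : ι => μ₀))
    (hp1 : ∫ x, p x ∂(Measure.pi fun _ : ι => μ₀) = 1) (hq0 : ∀ x, 0 ≤ q x) (hqm : Measurable q)
    (hqi : Integrable q (Measure.pi fun _ : ι => μ₀))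
    (hq1 : ∫ x, q x ∂(Measure.pi fun _ : ι => μ₀) = 1)
    (d : ι → ι → ℕ) (hsymm : ∀ a b, d a b = d b a) (htri : ∀ a b c, d a c ≤ d a b + d b c)
    {Φ : (ι → α) → (ι → α)} (hΦm : Measurable Φ)
    (hν : (Measure.pi fun _ : ι => μ₀).map Φ
      = (Measure.pi fun _ : ι => μ₀).withDensity fun x => ENNReal.ofReal (q x))
    {N : ι → Set ι} (hΦ : ∀ i, DependsOn (fun W => Φ W i) (N i)) {r : ℕ}
    (hN : ∀ i, ∀ j ∈ N i, d i j ≤ r) {acc : ℝ}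
    (hacc : acc ≤ ∫ x, ∫ y, min (p x * q y) (p y * q x) ∂(Measure.pi fun _ : ι => μ₀)
      ∂(Measure.pi fun _ : ι => μ₀))
    {A B : (ι → α) → ℝ} (hAm : Measurable A) (hBm : Measurable B) {a b : ℝ} (hAa : ∀ x, |A x| ≤ a)
    (hBb : ∀ x, |B x| ≤ b) {S T : Set ι} (hA : DependsOn A S) (hB : DependsOn B T)
    (hsep : ∀ i ∈ S, ∀ j ∈ T, 2 * r < d i j) :
    |∫ U, A U * B U ∂((Measure.pi fun _ : ι => μ₀).withDensity fun x => ENNReal.ofReal (p x))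
        - (∫ U, A U ∂((Measure.pi fun _ : ι => μ₀).withDensity fun x => ENNReal.ofReal (p x)))
          * ∫ U, B U ∂((Measure.pi fun _ : ι => μ₀).withDensity fun x => ENNReal.ofReal (p x))|
      ≤ 4 * (1 - acc) * (a * b) := by
  haveI := isProbabilityMeasure_withDensity_ofReal hp0 hpi hp1
  have hclose : IntegralClose ((Measure.pi fun _ : ι => μ₀).withDensity fun x => ENNReal.ofReal (p x))
      ((Measure.pi fun _ : ι => μ₀).map Φ) (2 * (1 - acc)) := by
    rw [hν]
    exact integralClose_of_meanAccept hp0 hpm hpi hp1 hq0 hqm hqi hq1 hacc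
  have h := abs_cov_le_two_mul_of_integralClose_pushforward μ₀ _ d hsymm htri hΦm hΦ hN hclose hAm hBm
    hAa hBb hA hB hsep
  linarith

/-- **FOOTPRINT LAW, threshold `4 (1 - acc) a b`**: a witness pair `≥ sep` apart with `|Cov| ≥ m > 4 (1 - acc) a b`
forces `sep ≤ 2 r`. -/
theorem sep_le_two_mul_range_of_meanAccept_four {p q : (ι → α) → ℝ} (hp0 : ∀ x, 0 ≤ p x)
    (hpm : Measurable p) (hpi : Integrable p (Measure.pi fun _ : ι => μ₀))
    (hp1 : ∫ x, p x ∂(Measure.pi fun _ : ι => μ₀) = 1) (hq0 : ∀ x, 0 ≤ q x) (hqm : Measurable q)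
    (hqi : Integrable q (Measure.pi fun _ : ι => μ₀))
    (hq1 : ∫ x, q x ∂(Measure.pi fun _ : ι => μ₀) = 1)
    (d : ι → ι → ℕ) (hsymm : ∀ a b, d a b = d b a) (htri : ∀ a b c, d a c ≤ d a b + d b c)
    {Φ : (ι → α) → (ι → α)} (hΦm : Measurable Φ)
    (hν : (Measure.pi fun _ : ι => μ₀).map Φ
      = (Measure.pi fun _ : ι => μ₀).withDensity fun x => ENNReal.ofReal (q x))
    {N : ι → Set ι} (hΦ : ∀ i, DependsOn (fun W => Φ W i) (N i)) {r : ℕ}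
    (hN : ∀ i, ∀ j ∈ N i, d i j ≤ r) {acc : ℝ}
    (hacc : acc ≤ ∫ x, ∫ y, min (p x * q y) (p y * q x) ∂(Measure.pi fun _ : ι => μ₀)
      ∂(Measure.pi fun _ : ι => μ₀))
    {A B : (ι → α) → ℝ} (hAm : Measurable A) (hBm : Measurable B) {a b : ℝ} (hAa : ∀ x, |A x| ≤ a)
    (hBb : ∀ x, |B x| ≤ b) {S T : Set ι} (hA : DependsOn A S) (hB : DependsOn B T) {sep : ℕ}
    (hfar : ∀ i ∈ S, ∀ j ∈ T, sep ≤ d i j) {m : ℝ}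
    (hm : m ≤ |∫ U, A U * B U ∂((Measure.pi fun _ : ι => μ₀).withDensity fun x => ENNReal.ofReal (p x))
        - (∫ U, A U ∂((Measure.pi fun _ : ι => μ₀).withDensity fun x => ENNReal.ofReal (p x)))
          * ∫ U, B U ∂((Measure.pi fun _ : ι => μ₀).withDensity fun x => ENNReal.ofReal (p x))|)
    (hacc_m : 4 * (1 - acc) * (a * b) < m) : sep ≤ 2 * r := by
  by_contra hcon
  have hsep : ∀ i ∈ S, ∀ j ∈ T, 2 * r < d i j :=
    fun i hi j hj => lt_of_lt_of_le (not_le.1 hcon) (hfar i hi j hj)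
  exact absurd (hm.trans (abs_cov_le_four_mul_of_meanAccept_of_range μ₀ hp0 hpm hpi hp1 hq0 hqm hqi hq1
    d hsymm htri hΦm hν hΦ hN hacc hAm hBm hAa hBb hA hB hsep)) (not_le.2 hacc_m)

end Range

/-! ### The lattice gauge instance -/

namespace Gauge

open Literature.MathematicalPhysics.QuantumFieldTheory
open Literature.MathematicalPhysics.QuantumFieldTheory.Luscher2010

variable {d L n : ℕ} [NeZero L]

/-- **THEOREM Q♯ for lattice gauge theory** (`G = SU(n)`, `S` continuous, any coupling and volume): the tree's
`Gauge.abs_cov_boltzmann_le_of_meanAccept` with `6 (1 - acc) a b` replaced by `4 (1 - acc) a b`. -/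
theorem abs_cov_boltzmann_le_four_mul_of_meanAccept
    {S : GaugeConfig d L (Matrix.specialUnitaryGroup (Fin n) ℂ) → ℝ} (hS : Continuous S)
    (dist : Edge d L → Edge d L → ℕ) (hsymm : ∀ e e', dist e e' = dist e' e)
    (htri : ∀ e e' e'', dist e e'' ≤ dist e e' + dist e' e'')
    {Φ : GaugeConfig d L (Matrix.specialUnitaryGroup (Fin n) ℂ) →
      GaugeConfig d L (Matrix.specialUnitaryGroup (Fin n) ℂ)} (hΦm : Measurable Φ)
    {q : GaugeConfig d L (Matrix.specialUnitaryGroup (Fin n) ℂ) → ℝ} (hq0 : ∀ U, 0 ≤ q U)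
    (hqm : Measurable q)
    (hν : (trivialMeasure (Matrix.specialUnitaryGroup (Fin n) ℂ) d L).map Φ
      = (trivialMeasure (Matrix.specialUnitaryGroup (Fin n) ℂ) d L).withDensity
          fun U => ENNReal.ofReal (q U))
    {N : Edge d L → Set (Edge d L)} (hΦ : ∀ e, DependsOn (fun W => Φ W e) (N e)) {r : ℕ}
    (hN : ∀ e, ∀ e' ∈ N e, dist e e' ≤ r) {acc : ℝ}
    (hacc : acc ≤ ∫ U, ∫ U', min (Real.exp (-S U) / (partitionFn S).toReal * q U')
        (Real.exp (-S U') / (partitionFn S).toReal * q U)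
        ∂(trivialMeasure (Matrix.specialUnitaryGroup (Fin n) ℂ) d L)
        ∂(trivialMeasure (Matrix.specialUnitaryGroup (Fin n) ℂ) d L))
    {A B : GaugeConfig d L (Matrix.specialUnitaryGroup (Fin n) ℂ) → ℝ} (hAm : Measurable A)
    (hBm : Measurable B) {a b : ℝ} (hAa : ∀ U, |A U| ≤ a) (hBb : ∀ U, |B U| ≤ b)
    {SA SB : Set (Edge d L)} (hA : DependsOn A SA) (hB : DependsOn B SB)
    (hsep : ∀ e ∈ SA, ∀ e' ∈ SB, 2 * r < dist e e') :
    |∫ U, A U * B U ∂(boltzmannMeasure S)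
        - (∫ U, A U ∂(boltzmannMeasure S)) * ∫ U, B U ∂(boltzmannMeasure S)|
      ≤ 4 * (1 - acc) * (a * b) := by
  obtain ⟨hp0, hpm, hpi, hp1⟩ := density_boltzmann_spec (d := d) (L := L) hS
  obtain ⟨hqi, hq1⟩ := integrable_of_map_eq_withDensity (d := d) (L := L) hΦm hq0 hqm hν
  rw [boltzmannMeasure_eq_withDensity hS]
  unfold trivialMeasure at hpi hp1 hqi hq1 hν hacc ⊢
  exact abs_cov_le_four_mul_of_meanAccept_of_range
    (haarProbability (Matrix.specialUnitaryGroup (Fin n) ℂ))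
    hp0 hpm hpi hp1 hq0 hqm hqi hq1 dist hsymm htri hΦm hν hΦ hN hacc hAm hBm hAa hBb hA hB hsep

/-- **FOOTPRINT LAW for lattice gauge theory, threshold `4 (1 - acc) a b`.** -/
theorem sep_le_two_mul_range_of_meanAccept_four
    {S : GaugeConfig d L (Matrix.specialUnitaryGroup (Fin n) ℂ) → ℝ} (hS : Continuous S)
    (dist : Edge d L → Edge d L → ℕ) (hsymm : ∀ e e', dist e e' = dist e' e)
    (htri : ∀ e e' e'', dist e e'' ≤ dist e e' + dist e' e'')
    {Φ : GaugeConfig d L (Matrix.specialUnitaryGroup (Fin n) ℂ) →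
      GaugeConfig d L (Matrix.specialUnitaryGroup (Fin n) ℂ)} (hΦm : Measurable Φ)
    {q : GaugeConfig d L (Matrix.specialUnitaryGroup (Fin n) ℂ) → ℝ} (hq0 : ∀ U, 0 ≤ q U)
    (hqm : Measurable q)
    (hν : (trivialMeasure (Matrix.specialUnitaryGroup (Fin n) ℂ) d L).map Φ
      = (trivialMeasure (Matrix.specialUnitaryGroup (Fin n) ℂ) d L).withDensity
          fun U => ENNReal.ofReal (q U))
    {N : Edge d L → Set (Edge d L)} (hΦ : ∀ e, DependsOn (fun W => Φ W e) (N e)) {r : ℕ}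
    (hN : ∀ e, ∀ e' ∈ N e, dist e e' ≤ r) {acc : ℝ}
    (hacc : acc ≤ ∫ U, ∫ U', min (Real.exp (-S U) / (partitionFn S).toReal * q U')
        (Real.exp (-S U') / (partitionFn S).toReal * q U)
        ∂(trivialMeasure (Matrix.specialUnitaryGroup (Fin n) ℂ) d L)
        ∂(trivialMeasure (Matrix.specialUnitaryGroup (Fin n) ℂ) d L))
    {A B : GaugeConfig d L (Matrix.specialUnitaryGroup (Fin n) ℂ) → ℝ} (hAm : Measurable A)
    (hBm : Measurable B) {a b : ℝ} (hAa : ∀ U, |A U| ≤ a) (hBb : ∀ U, |B U| ≤ b)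
    {SA SB : Set (Edge d L)} (hA : DependsOn A SA) (hB : DependsOn B SB) {sep : ℕ}
    (hfar : ∀ e ∈ SA, ∀ e' ∈ SB, sep ≤ dist e e') {m : ℝ}
    (hm : m ≤ |∫ U, A U * B U ∂(boltzmannMeasure S)
        - (∫ U, A U ∂(boltzmannMeasure S)) * ∫ U, B U ∂(boltzmannMeasure S)|)
    (hacc_m : 4 * (1 - acc) * (a * b) < m) : sep ≤ 2 * r := by
  by_contra hcon
  have hsep : ∀ e ∈ SA, ∀ e' ∈ SB, 2 * r < dist e e' :=
    fun e he e' he' => lt_of_lt_of_le (not_le.1 hcon) (hfar e he e' he')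
  exact absurd (hm.trans (abs_cov_boltzmann_le_four_mul_of_meanAccept hS dist hsymm htri hΦm hq0 hqm hν
    hΦ hN hacc hAm hBm hAa hBb hA hB hsep)) (not_le.2 hacc_m)

end Gauge

namespace Sharp

/-- The law `|Cov_π(A, B)| ≤ 4 (1 - acc) a b` HOLDS in this setting (instance of §3). -/
theorem linear_law_four (p q A B : Bool × Bool → ℝ) (a b acc : ℝ) (hp0 : ∀ z, 0 ≤ p z)
    (hpm : Measurable p) (hpi : Integrable p (Measure.count : Measure (Bool × Bool)))
    (hp1 : ∫ z, p z ∂(Measure.count : Measure (Bool × Bool)) = 1) (hq0 : ∀ z, 0 ≤ q z)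
    (hqm : Measurable q) (hqi : Integrable q (Measure.count : Measure (Bool × Bool)))
    (hq1 : ∫ z, q z ∂(Measure.count : Measure (Bool × Bool)) = 1)
    (hacc : acc ≤ ∫ x, ∫ y, min (p x * q y) (p y * q x) ∂(Measure.count : Measure (Bool × Bool))
      ∂(Measure.count : Measure (Bool × Bool)))
    (hAm : Measurable A) (hBm : Measurable B) (hAa : ∀ z, |A z| ≤ a) (hBb : ∀ z, |B z| ≤ b)
    (hfac : ∫ z, A z * B z ∂((Measure.count : Measure (Bool × Bool)).withDensity
        fun z => ENNReal.ofReal (q z))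
      = (∫ z, A z ∂((Measure.count : Measure (Bool × Bool)).withDensity fun z => ENNReal.ofReal (q z)))
        * ∫ z, B z ∂((Measure.count : Measure (Bool × Bool)).withDensity fun z => ENNReal.ofReal (q z))) :
    |∫ z, A z * B z ∂((Measure.count : Measure (Bool × Bool)).withDensity fun z => ENNReal.ofReal (p z))
        - (∫ z, A z ∂((Measure.count : Measure (Bool × Bool)).withDensity fun z => ENNReal.ofReal (p z)))
          * ∫ z, B z ∂((Measure.count : Measure (Bool × Bool)).withDensity fun z => ENNReal.ofReal (p z))|
      ≤ 4 * (1 - acc) * (a * b) :=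
  abs_cov_le_four_mul_of_meanAccept hp0 hpm hpi hp1 hq0 hqm hqi hq1 hacc hAm hBm hAa hBb hfac

end Sharp

end Summit.Ventures.LatticeQCDFlow.TrivializingMaps
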